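import Summits.CriticalPhenomena.CardyFormulaZ2.Theorems.CardyAnchoredRigiditySubseqCardyStubCountableApproxBondNearCrude
import Literature.Probability.RandomPlanarGeometry.ChordalCurveFamily

/-!
# Full limits of bond-`ℤ²` crossing probabilities do not jump under small deformations
# (stub `stub_fullLimitPerturbation`, groundwork G2 "no jump")

Sub-goal of the `SimilarityUpgrade` crux (stmt-CriticalPhenomena-4597, line `registered`, lead c4 wave 2).

THE STATEMENT.  Let `Φ` be a FULL `δ → 0⁺` limit of G02's bond-`ℤ²` crossing probabilities, i.e.
`bondDomainCrossingProb R δ → Φ R` for every conformal rectangle `R`.  Then for every `R` and `ε > 0` there is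
`η > 0` such that for every plane homeomorphism `T` moving no point of the closed unit neighbourhood
`cthickening 1 (closure R.carrier)` by more than `η`, `|Φ (R.map T) - Φ R| ≤ ε`.

THE PROOF (bookkeeping over three landed theorems of the tree + a limit).
* `stub_DomainPerturbation` (Schramm–Smirnov 2011, §5, eq. (5.1)): with `ε/3`, an `η > 0` such that for every such
  `T`, eventually in `δ → 0⁺`, the CRUDE standard crossing probabilities satisfy
  `|bondStdCrossingProb (R.map T) δ - bondStdCrossingProb R δ| ≤ ε/3`; pushed through `δ ↦ δ/√2`
  (`tendsto_div_sqrt_two`) to align meshes.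
* `stub_bondNearCrude` for `R` and for `R.map T`: eventually `|bondDomainCrossingProb X δ - bondStdCrossingProb X (δ/√2)| ≤ ε/3`.
* Hence eventually `|bondDomainCrossingProb (R.map T) δ - bondDomainCrossingProb R δ| ≤ ε`, and passing to the
  limit along the non-trivial filter `𝓝[>] 0` with the full-limit hypothesis at `R.map T` and at `R`
  (`le_of_tendsto`) gives `|Φ (R.map T) - Φ R| ≤ ε`.

References: O. Schramm, S. Smirnov, *On the scaling limits of planar percolation*, Ann. Probab. 39 (2011), §5,
Lemma 5.1 and eq. (5.1); B. Bollobás, O. Riordan, *Percolation* (2006), Ch. 7 Claim 19.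
-/

noncomputable section

namespace Summit.CriticalPhenomena.CardyFormulaZ2.Cruxes.SimilarityUpgrade.Stubs

open Filter Topology Set MeasureTheory
open Literature.Probability.RandomPlanarGeometry
open Literature.Probability.Percolation
open Summit.CriticalPhenomena.CardyFormulaZ2.Theorems (tendsto_div_sqrt_two)
open Summit.CriticalPhenomena.CardyFormulaZ2.Theorems.CornerLineDescent.SymmetricSeed (bondStdCrossingProb
  stub_DomainPerturbation)
open Summit.CriticalPhenomena.CardyFormulaZ2.Cruxes.SubseqCardy.Birth (stub_bondNearCrude)

/-- MESH-LEVEL NO-JUMP.  For every conformal rectangle `R` and `ε > 0` there is `η > 0` such that for every plane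
homeomorphism `T` with `dist (T z) z ≤ η` on `cthickening 1 (closure R.carrier)`, eventually as `δ → 0⁺`,
`|bondDomainCrossingProb (R.map T) δ - bondDomainCrossingProb R δ| ≤ ε`: `stub_DomainPerturbation` at `ε/3`
(meshes realigned by `tendsto_div_sqrt_two`) sandwiched between `stub_bondNearCrude` for `R` and for `R.map T`.
[folklore] -/
theorem fullLimitPerturbation_eventually (R : ConformalRectangle) {ε : ℝ} (hε : 0 < ε) :
    ∃ η : ℝ, 0 < η ∧ ∀ T : ℂ ≃ₜ ℂ,
      (∀ z ∈ Metric.cthickening 1 (closure R.carrier), dist (T z) z ≤ η) →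
        ∀ᶠ δ in 𝓝[>] (0 : ℝ), |bondDomainCrossingProb (R.map T) δ - bondDomainCrossingProb R δ| ≤ ε := by
  have hε3 : 0 < ε / 3 := by positivity
  obtain ⟨η, hη, hpert⟩ := stub_DomainPerturbation R (ε / 3) hε3
  refine ⟨η, hη, fun T hT => ?_⟩
  have hev : ∀ᶠ δ in 𝓝[>] (0 : ℝ), |bondStdCrossingProb (R.map T) (δ / Real.sqrt 2) -
      bondStdCrossingProb R (δ / Real.sqrt 2)| ≤ ε / 3 :=
    tendsto_div_sqrt_two.eventually (hpert T hT)
  filter_upwards [stub_bondNearCrude R _ hε3, stub_bondNearCrude (R.map T) _ hε3, hev] with δ h1 h2 h3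
  simp only [bondStdCrossingProb] at h3
  rw [abs_le] at h1 h2 h3 ⊢
  constructor <;> linarith [h1.1, h1.2, h2.1, h2.2, h3.1, h3.2]

/-- REGISTERED STUB `stub_fullLimitPerturbation` (groundwork G2 "no jump", crux `SimilarityUpgrade`, lead c4):
a FULL limit `Φ` of the bond-`ℤ²` crossing probabilities changes by at most `ε` when the conformal rectangle is
deformed by a plane homeomorphism `T` moving no point of `cthickening 1 (closure R.carrier)` by more than `η`.
Proof: the mesh-level estimate `fullLimitPerturbation_eventually`, then `le_of_tendsto` along the non-trivial
filter `𝓝[>] 0` applied to `|bondDomainCrossingProb (R.map T) δ - bondDomainCrossingProb R δ| → |Φ (R.map T) - Φ R|`.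
[folklore] -/
theorem stub_fullLimitPerturbation :
    ∀ Φ : ConformalRectangle → ℝ,
      (∀ R : ConformalRectangle, Tendsto (bondDomainCrossingProb R) (𝓝[>] (0 : ℝ)) (𝓝 (Φ R))) →
      ∀ (R : ConformalRectangle) (ε : ℝ), 0 < ε → ∃ η : ℝ, 0 < η ∧ ∀ T : ℂ ≃ₜ ℂ,
        (∀ z ∈ Metric.cthickening 1 (closure R.carrier), dist (T z) z ≤ η) →
        |Φ (R.map T) - Φ R| ≤ ε := by
  intro Φ hΦ R ε hε
  obtain ⟨η, hη, hpert⟩ := fullLimitPerturbation_eventually R hε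
  refine ⟨η, hη, fun T hT => ?_⟩
  have hlim : Tendsto (fun δ : ℝ => |bondDomainCrossingProb (R.map T) δ - bondDomainCrossingProb R δ|)
      (𝓝[>] (0 : ℝ)) (𝓝 |Φ (R.map T) - Φ R|) :=
    ((hΦ (R.map T)).sub (hΦ R)).abs
  exact le_of_tendsto hlim (hpert T hT)

end Summit.CriticalPhenomena.CardyFormulaZ2.Cruxes.SimilarityUpgrade.Stubs

end
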